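import Summits.ABC.IUTFork.Cor312TeamAAssembly
import Summits.ABC.IUTFork.Cor312ThetaAdmReal
import Summits.ABC.IUTFork.Cor312LogKummerRoute2Checks
import HarnessLib

/-!
# [IUTchIII] Cor. 3.12 — TEAM A ↔ TEAM B bridge: the two residual inputs compose (TEAM B, B-1 coda)

Record-only file (D-0012) of the abc-iut cell (Cor. 3.12 strategy TEAM B «estimate / log-Kummer», D-0067,
seat abc-iut-c312-11 = B1; coda to rows B-1/A-4); TAKES NO SIDE; proof-only. TEAM A's master composition
(`Cor312TeamAAssembly`, c312-9) runs the printed proof end to end modulo READING 0 — the pointwise volume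
interface `qLocal ≤ thetaLocal` — and TEAM B's route (`Cor312LogKummerRoute`/`2`, p411119/p411648) reaches
the same Statement modulo `VolumeTransport` resp. `QFrobComparison` (GAP-LEDGER row G-c312-11-1). THIS file
records, in the kernel, that the two teams' residual inputs COMPOSE — the B-INPUT implies Team A's gap
reading, so for the 13:00Z adjudication ONE gap suffices and the ledger rows are ordered by strength:

* `hgap_of_volumeTransport` — the B-INPUT (with admissible Kummer images) yields READING 0's hypothesis:
  Team B's `qLocal_le_thetaLocal_untopD` is literally Team A's `hgap` input. One line.
* `teamA_statement_of_volumeTransport` / `teamA_statement_of_qFrobComparison` — hence the TEAM A master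
  route closes under the TEAM B inputs: the printed chain (A) and the estimate route (B) are the SAME
  adjudication surface, `B-INPUT ⟹ READING 0 ⟹ Statement`, each arrow kernel-checked. (The direct
  `statement_of_volumeTransport` gives the same conclusion without the chain; the point here is the
  cross-team factoring, not a new consequence.)
* QUANTIFIER ORDER, for the ledger (A1's caution in `Cor312TeamAAssembly`, skel FORK FINDING 23:23:08Z):
  all of {R2, R3, R4, READING 0, `VolumeTransport`, `QFrobComparison`} are PER-PACKET and hence
  SUFFICIENT but strictly stronger than the printed GLOBAL comparison of the two procession-normalized
  numbers; G-c312-11-1 records the log-Kummer SUFFICIENT form; the faithful GLOBAL gap statement (Step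
  (xi) soundness at the link-identified input strip, skel XXIV `ForkLocalGlobal`) is Team A's row. The
  implication order of the catalogue, restricted to what is landed:
  `QFrobEqualityAt 0 ⟹ QFrobComparison ⟹ (mod KummerA, adm) VolumeTransport ⟹ (mod BridgeHyps, adm)
  READING 0 ⟹ (mod BridgeHyps, |log q| > 0) Statement`.

* `statement_of_volumeTransportAt_real` — TEAM B capstone, LAYER-1 form (B2's `Cor312TeamBCapstone`
  carries the layer-2 form through the typed Thm. 3.11 (ii)): over B2's lattice-carrying realisation
  data (`Cor312ThetaAdmReal`, rows B-2/B-3/B-4), the printed Statement follows from the bridge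
  hypotheses plus ONE uniform per-packet comparison at a single lattice position (`VolumeTransportAt m₀`,
  e.g. the (xi-a) gluing position `m₀ = 0`) — everything else on the route is discharged.
* `GapWitness.thm311_bridgeHyps_not_imp_b_input` — **INDEPENDENCE, both layers**: contraposing Team A's
  gap witness through the route, the B-INPUT provably does not follow from the whole typed Theorem 3.11
  + bridge hypotheses + positivity + admissibility — the layer-1 delta (`¬ VolumeTransport`) added to
  the layer-2 facts of the RQ7 companion `Cor312LogKummerRoute2Checks` (w5-d143, p413508; imported and
  cited, nothing re-proved). Sufficiency (§1–§3) + independence (§4) = the adjudication sandwich of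
  G-c312-11-1: the B-INPUT is exactly the non-following inference of the log-Kummer route, at this
  level of typing.

Sources: [IUTchIII] kurims `paper:url-4b091feeb646` pp. 174–186 (the proof), p. 184 l. 30–34 ((xi-g));
the landed files cited above. [claim: Mochizuki2012, status: disputed]
Deliberately NOT here: any claim that either input holds for an instantiated REAL setting; any judgement.
-/

namespace Summit.ABC

namespace IUTFork

namespace Cor312Vol

open Thm311 Cor312 Literature.IUT.LogThetaLattice

/-! ## 1. Situation level: the B-INPUT gives Team A's READING-0 hypothesis -/

section SituationLevel

variable {T : ThetaIndex} {S : Situation T} {P : Cor312.Setting S}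

/-- **The B-INPUT implies Team A's gap reading**: under the bridge hypotheses and admissible Kummer
images, `VolumeTransport` yields READING 0's pointwise interface `qLocal ≤ thetaLocal` — Team B's
`qLocal_le_thetaLocal_untopD` IS Team A's `hgap` input. [folklore] -/
theorem hgap_of_volumeTransport (H : BridgeHyps P) (hadm : ThetaRegionsAdm P)
    (hvt : VolumeTransport P) :
    ∀ (i : Fin T.lstar) (vQ : T.VQ),
      P.qLocal (Setting.labelSucc i) vQ ≤ (P.thetaLocal (Setting.labelSucc i) vQ).untopD 0 :=
  fun i vQ => qLocal_le_thetaLocal_untopD H hadm hvt i vQ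

/-- **Team A's master route closes under the Team B input** — the printed-chain composition
(`teamA_statement_of_readings`) with its gap supplied by `VolumeTransport`: the two teams' adjudication
surfaces coincide. [claim: Mochizuki2012, status: disputed] -/
theorem teamA_statement_of_volumeTransport (H : BridgeHyps P) (hq : P.AbsLogQPos)
    (hadm : ThetaRegionsAdm P) (hvt : VolumeTransport P) : P.Statement :=
  teamA_statement_of_readings H hq (hgap_of_volumeTransport H hadm hvt)

end SituationLevel

/-! ## 2. Lattice level: the same through the typed Theorem 3.11 (ii) -/

section LatticeLevel

variable {T : ThetaIndex} {S' : LatticeSituation T} {P : Cor312.Setting S'.toSituation}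

/-- The (xi-g) comparison (`QFrobComparison`, row G-c312-11-1) gives Team A's gap reading, through the
typed Thm. 3.11 (ii) (a). [folklore] -/
theorem hgap_of_qFrobComparison (H : BridgeHyps P) (hka : (S'.col P.n).KummerA (S'.D P.n))
    (hadm : ThetaRegionsAdm P) (h : QFrobComparison P) :
    ∀ (i : Fin T.lstar) (vQ : T.VQ),
      P.qLocal (Setting.labelSucc i) vQ ≤ (P.thetaLocal (Setting.labelSucc i) vQ).untopD 0 :=
  hgap_of_volumeTransport H hadm
    (volumeTransport_of_frobVolumeTransport hka hadm
      (frobVolumeTransport_of_qFrobComparison hka (qRegionAdm_of_hul_adm P) h))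

/-- **Team A's master route closes under Team B's residual input** `QFrobComparison` + the typed
Thm. 3.11 (ii) (a): one gap statement serves both routes. [claim: Mochizuki2012, status: disputed] -/
theorem teamA_statement_of_qFrobComparison (H : BridgeHyps P) (hq : P.AbsLogQPos)
    (hka : (S'.col P.n).KummerA (S'.D P.n)) (hadm : ThetaRegionsAdm P) (h : QFrobComparison P) :
    P.Statement :=
  teamA_statement_of_readings H hq (hgap_of_qFrobComparison H hka hadm h)

end LatticeLevel

/-! ## 3. TEAM B CAPSTONE: the Statement modulo ONE uniform comparison, over realisation data -/

section Capstone

open Literature.IUT.LogVolume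

variable {T : ThetaIndex} {S : Situation T} (P : Cor312.Setting S)
variable {W : T.Label → T.VQ → Type*} [∀ j vQ, AddCommGroup (W j vQ)]
  [∀ j vQ, TopologicalSpace (W j vQ)] [∀ j vQ, IsTopologicalAddGroup (W j vQ)]
  [∀ j vQ, MeasurableSpace (W j vQ)] [∀ j vQ, BorelSpace (W j vQ)]

/-- **TEAM B capstone, LAYER-1 form** (the direct-input sibling of B2's `Cor312TeamBCapstone`
`teamB_capstone_of_latticeRealisations`, which is the layer-2 form through the typed Thm. 3.11 (ii) with
input `QFrobEqualityAt 0`; this one takes `VolumeTransportAt m₀` directly and needs no `KummerA`): over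
B2's lattice-carrying realisation data
(`Cor312ThetaAdmReal`: admissibility = positive finite Haar volume of the container image; each Kummer
transport realised by a lattice-preserving homeomorphism `ψ_m` of one reference region `R`), the printed
`Statement` of Cor. 3.12 follows from the bridge hypotheses plus **ONE uniform per-packet comparison at
a single lattice position `m₀`** — `VolumeTransportAt P m₀`, e.g. the (xi-a) gluing position `m₀ = 0`.
Everything else on the B route is DISCHARGED: `ThetaRegionsAdm` by
`thetaRegionsAdm_of_latticeRealisations` (B2, row B-3), the `∃ m` collapse by
`volumeTransport_iff_at_of_latticeRealisations` (B2: single-image volumes are `m`-independent), the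
volume engine by `statement_of_volumeTransport` (B1, row B-1). The comparison itself is the residual
B-INPUT of GAP-LEDGER row G-c312-11-1; nothing here asserts it. [claim: Mochizuki2012, status: disputed] -/
theorem statement_of_volumeTransportAt_real (H : BridgeHyps P)
    (Λ : ∀ j vQ, IntegralStructure (W j vQ))
    (e : ∀ (j : T.Label) (vQ : T.VQ), S.L.Packet j vQ → W j vQ)
    (ψ : ℤ → ∀ (j : T.Label) (vQ : T.VQ), W j vQ ≃ₜ+ W j vQ)
    (R : ∀ (j : T.Label) (vQ : T.VQ), Set (S.L.Packet j vQ))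
    (hAdm : ∀ (j : T.Label) (vQ : T.VQ) (A : Set (S.L.Packet j vQ)),
      (S.D P.n).Adm j vQ A ↔ 0 < (Λ j vQ).haar (e j vQ '' A) ∧ (Λ j vQ).haar (e j vQ '' A) < ⊤)
    (hψ : ∀ (m : ℤ) (j : T.Label) (vQ : T.VQ), ∃ Λ₀ : IntegralStructure (W j vQ),
      ψ m j vQ '' (Λ₀ : Set (W j vQ)) = (Λ₀ : Set (W j vQ)))
    (hthetaEq : ∀ (m : ℤ) (i : Fin T.lstar) (vQ : T.VQ),
      e (Setting.labelSucc i) vQ '' P.thetaRegion m (Setting.labelSucc i) vQ =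
        ψ m (Setting.labelSucc i) vQ '' (e (Setting.labelSucc i) vQ '' R (Setting.labelSucc i) vQ))
    (hR : ∀ (i : Fin T.lstar) (vQ : T.VQ),
      0 < (Λ (Setting.labelSucc i) vQ).haar
          (e (Setting.labelSucc i) vQ '' R (Setting.labelSucc i) vQ) ∧
        (Λ (Setting.labelSucc i) vQ).haar
          (e (Setting.labelSucc i) vQ '' R (Setting.labelSucc i) vQ) < ⊤)
    {m₀ : ℤ} (hvt : VolumeTransportAt P m₀) : P.Statement :=
  statement_of_volumeTransport P H
    (thetaRegionsAdm_of_latticeRealisations P Λ e ψ R hAdm hψ hthetaEq hR)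
    (volumeTransport_of_at hvt)

end Capstone

/-! ## 4. INDEPENDENCE, layer-1 delta: `VolumeTransport` fails on the gap witness too

The RQ7 companion `Cor312LogKummerRoute2Checks` (seat abc-iut-w5-d143, p413508 — imported) already
records the layer-2 independence on Team A's gap witness (`GapWitness.gapSetting_not_qFrobComparison`,
`…_not_frobVolumeTransport`, `…_not_qFrobEqualityAt`, and the `∃`-forms
`thm311_bridgeHyps_adm_not_imp_qFrobComparison` / `…_qFrobEqualityAt_zero`) together with the
equivalences `qFrobComparison_iff_volumeTransport` etc. This section adds only the LAYER-1 delta — the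
failure of `VolumeTransport` itself — and the combined `∃`-form over both layers, completing the
adjudication sandwich for GAP-LEDGER row G-c312-11-1: the B-INPUT is SUFFICIENT (§1–§3, layer 1/2 routes)
and NOT DERIVABLE from the typed Thm. 3.11 + bridge hypotheses + positivity + admissibility (witnessed)
— it is exactly the non-following inference on the log-Kummer route, at this level of typing. -/

namespace GapWitness

open Cor312.Checks

/-- On the gap witness, layer 1's `VolumeTransport` FAILS (contrapositive of the route through the
witness's `¬ Statement`; admissibility there is `gapSetting_thetaRegionsAdm` of p413508). [folklore] -/
theorem gapSetting_not_volumeTransport : ¬ VolumeTransport gapSetting :=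
  not_volumeTransport_of_not_statement gapSetting_bridgeHyps gapSetting_thetaRegionsAdm
    gapSetting_not_statement

/-- **THE B-SIDE ADJUDICATION STATEMENT, both layers (kernel form)**: there is a full situation
satisfying the whole typed Theorem 3.11 and a verbatim setting over it satisfying all bridge hypotheses,
`|log(q)| > 0` and admissibility of the Kummer images, on which BOTH forms of the B-INPUT fail — so
`VolumeTransport` / `QFrobComparison` (GAP-LEDGER G-c312-11-1) do NOT follow from the typed Theorem 3.11
+ the named side conditions, while by `statement_of_volumeTransport` / `statement_of_thm311` they
SUFFICE for the printed Statement: the B-INPUT is exactly the non-following inference of the log-Kummer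
route. (The `QFrobComparison` conjunct is p413508's `gapSetting_not_qFrobComparison`, cited, not
re-proved.) [claim: Mochizuki2012, status: disputed] -/
theorem thm311_bridgeHyps_not_imp_b_input :
    ∃ (T : ThetaIndex) (S'' : FullSituation T) (P : Cor312.Setting S''.toSituation),
      S''.Statement ∧ BridgeHyps P ∧ P.AbsLogQPos ∧ ThetaRegionsAdm P ∧
        ¬ VolumeTransport P ∧ ¬ QFrobComparison (S' := S''.toLatticeSituation) P :=
  ⟨toyIndex, gapFull, gapSetting, gapFull_statement, gapSetting_bridgeHyps, gapSetting_absLogQPos,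
    gapSetting_thetaRegionsAdm, gapSetting_not_volumeTransport, gapSetting_not_qFrobComparison⟩

end GapWitness

end Cor312Vol

end IUTFork

end Summit.ABC
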